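import Summits.BirchSwinnertonDyer.Rank1Residual.GaloisImage.TameNineTorsionValuation
import Summits.BirchSwinnertonDyer.Rank1Residual.GaloisImage.TameThreeTorsionValuationField
import HarnessLib

/-!
# The normal shape `y² = x³ + A x² + x` of a WILD potentially-supersingular curve at `3`:
# the exponent `v(A)⁶ = v(3)^m`, `m = v₃(j − 1728)`
# (cell `b2b-bsdres`, team n1011, seat p02 gen 3, OWNERS row T-b10 'wild tower at 3', file F1a)

HONEST FRAMING (cell `b2b-bsdres`, run/shared/lean/b2b/bsd-rank1-residual/, verbatim in every
file): the goal of the cell is to DELETE the COMBINATION-SHAPED residual classes of the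
Birch–Swinnerton-Dyer formula for ALL analytic-rank `≤ 1` elliptic curves over `ℚ` — "full BSD
formula for every rank `≤ 1` curve in class `C`" assembled STRICTLY from published theorems — so
that the rank-`≤ 1` remainder becomes exactly the CONSTRUCTION-SHAPED classes, which are TYPED
(missing-input `Prop`s), NOT attempted. This is not "finishing BSD". Team n1011 (N10 / N11, the
additive block X4 ∧ `p = 3`): research route on the CONSTRUCTION-SHAPED class X4; no claim beyond the
stated classes; nothing is booked. Theorems only (no definition, no named fact).

## What this file proves (local algebra over `ℚ̄`; `v` = the place over `3`, `t = v(3)`)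

Let `W` be a Weierstrass equation over `ℚ̄` in the NORMAL SHAPE `a₁ = a₃ = a₆ = 0`, `a₄ = 1`
(so `b₂ = 4a₂`, `b₄ = 2`, `b₆ = 0`, `b₈ = −1`, `c₆ = −32a₂(2a₂² − 9)`, `Δ = 16(a₂² − 4)`,
`(j − 1728)·Δ = c₆²`, `ψ₃ = 3X⁴ + 4a₂X³ + 6X² − 1`).  Every elliptic curve over `ℚ̄` has such an
equation (centre a `2`-torsion abscissa, rescale `a₄` to `1`; file F2 `WildThreeAdicTower`).

* §0 value-group helpers (`pow_lt_pow_iff_of_lt_one'`, `pow_injective_of_lt_one'`; injectivity of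
  `x ↦ xⁿ` is the tree's `pow_left_injective_of_ne_zero`).
* §1 the shape identities and **`valuation_a₂_of_shape_of_j`**: for an ELLIPTIC equation in normal
  shape with `v(j − 1728) = t^m`, `1 ≤ m ≤ 5`: `v(a₂) < 1`, `v(a₂² − 4) = 1` (so `v(Δ) = 1`) and
  **`v(a₂)⁶ = t^m`**.  For the elliptic curve this says: the Hasse invariant `A` of the good
  supersingular model over the semistable field has valuation `m/6`; the two-slope ("canonical
  subgroup") regime is `m ≤ 4`.  The three regimes `v(a₂) ≥ 1`, `t < v(a₂) < 1`, `v(a₂) ≤ t` give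
  `v(j − 1728) ≥ 1`, `= v(a₂)⁶`, `≤ t⁶` respectively.

Sequel files: `WildThreeTorsionValuation` (the `3`-torsion abscissae), `WildNineTorsionValuation`
(the `9`-torsion coordinates), `WildThreeAdicTower` (the tower for `m ∈ {1, 2, 4}`).
Numerics (EVIDENCE, `HOME/b2b-bsdres-n1011-p02/wild/WILD-TOWER-NOTE.md`): the predicted
valuations are reproduced exactly on 184/184 wild X4@3 cells + 6/6 Elkies controls.

References: N. Katz, *p-adic properties of modular schemes and modular forms* (1973) §3.10
(Hasse invariant and the canonical subgroup); J.-P. Serre, Invent. Math. 15 (1972) §1;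
Silverman *AEC* III.1, Ex. 3.7; N. Elkies, arXiv:math/0612734.
-/

noncomputable section

-- Exponents up to `162` occur on elements of the value group `(placeOver 3).ValueGroup` (a
-- quotient type on which numerals `x ^ 162` are unfolded by `whnf` during unification); the
-- default recursion depth (512) does not suffice for that unfolding.  Nothing else is affected.
set_option maxRecDepth 10000

open scoped Classical

open Polynomial WeierstrassCurve

namespace Summit.BirchSwinnertonDyer.Rank1Residual.GaloisImage

open Literature.NumberTheory.EllipticCurves
/-! ### §0 Generic helpers in the value group -/

section Generic

variable {Γ₀ : Type*} [LinearOrderedCommGroupWithZero Γ₀]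

/-- `t^a < t^b ↔ b < a` for `0 < t < 1`. [folklore] -/
theorem pow_lt_pow_iff_of_lt_one' {t : Γ₀} (ht0 : t ≠ 0) (ht1 : t < 1) {a b : ℕ} :
    t ^ a < t ^ b ↔ b < a := by
  constructor
  · intro h
    by_contra hle
    rw [not_lt] at hle
    exact absurd h (not_lt.mpr (pow_le_pow_of_le_one' ht1.le hle))
  · intro h
    exact pow_lt_pow_right_of_lt_one₀ (zero_lt_iff.mpr ht0) ht1 h

/-- `t^a = t^b → a = b` for `0 < t < 1`. [folklore] -/
theorem pow_injective_of_lt_one' {t : Γ₀} (ht0 : t ≠ 0) (ht1 : t < 1) {a b : ℕ}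
    (h : t ^ a = t ^ b) : a = b := by
  rcases lt_trichotomy a b with hab | hab | hab
  · exact absurd h (ne_of_gt ((pow_lt_pow_iff_of_lt_one' ht0 ht1).mpr hab))
  · exact hab
  · exact absurd h (ne_of_lt ((pow_lt_pow_iff_of_lt_one' ht0 ht1).mpr hab))

end Generic

/-! ### §1 The normal shape and its exponent `m = v₃(j − 1728)` -/

variable (W : WeierstrassCurve (AlgebraicClosure ℚ))

section Shape

variable {W}

/-- `b₂ = 4a₂` in normal shape. [folklore] -/
theorem b₂_of_shape (h1 : W.a₁ = 0) : W.b₂ = 4 * W.a₂ := by rw [WeierstrassCurve.b₂, h1]; ring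

/-- `b₄ = 2` in normal shape. [folklore] -/
theorem b₄_of_shape (h1 : W.a₁ = 0) (h3 : W.a₃ = 0) (h4 : W.a₄ = 1) : W.b₄ = 2 := by
  rw [WeierstrassCurve.b₄, h1, h3, h4]; ring

/-- `b₆ = 0` in normal shape. [folklore] -/
theorem b₆_of_shape (h3 : W.a₃ = 0) (h6 : W.a₆ = 0) : W.b₆ = 0 := by
  rw [WeierstrassCurve.b₆, h3, h6]; ring

/-- `b₈ = −1` in normal shape. [folklore] -/
theorem b₈_of_shape (h1 : W.a₁ = 0) (h3 : W.a₃ = 0) (h4 : W.a₄ = 1) (h6 : W.a₆ = 0) :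
    W.b₈ = -1 := by
  rw [WeierstrassCurve.b₈, h1, h3, h4, h6]; ring

/-- `c₆ = −32a₂(2a₂² − 9)` in normal shape. [folklore] -/
theorem c₆_of_shape (h1 : W.a₁ = 0) (h3 : W.a₃ = 0) (h4 : W.a₄ = 1) (h6 : W.a₆ = 0) :
    W.c₆ = -32 * W.a₂ * (2 * W.a₂ ^ 2 - 9) := by
  rw [WeierstrassCurve.c₆, b₂_of_shape h1, b₄_of_shape h1 h3 h4, b₆_of_shape h3 h6]; ring

/-- `Δ = 16(a₂² − 4)` in normal shape. [folklore] -/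
theorem Δ_of_shape (h1 : W.a₁ = 0) (h3 : W.a₃ = 0) (h4 : W.a₄ = 1) (h6 : W.a₆ = 0) :
    W.Δ = 16 * (W.a₂ ^ 2 - 4) := by
  rw [WeierstrassCurve.Δ, b₂_of_shape h1, b₄_of_shape h1 h3 h4, b₆_of_shape h3 h6,
    b₈_of_shape h1 h3 h4 h6]; ring

/-- `ψ₃ = 3X⁴ + 4a₂X³ + 6X² − 1` in normal shape, evaluated. [folklore] -/
theorem eval_Ψ₃_of_shape (h1 : W.a₁ = 0) (h3 : W.a₃ = 0) (h4 : W.a₄ = 1) (h6 : W.a₆ = 0)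
    (x : AlgebraicClosure ℚ) :
    W.Ψ₃.eval x = 3 * x ^ 4 + 4 * W.a₂ * x ^ 3 + 6 * x ^ 2 - 1 := by
  rw [eval_Ψ₃, b₂_of_shape h1, b₄_of_shape h1 h3 h4, b₆_of_shape h3 h6, b₈_of_shape h1 h3 h4 h6]
  ring

/-- **`(j − 1728)·Δ = c₆²`** for an elliptic curve (Mathlib's `1728Δ = c₄³ − c₆²`). [folklore] -/
theorem j_sub_mul_Δ_eq [W.IsElliptic] : (W.j - 1728) * W.Δ = W.c₆ ^ 2 := by
  have hc := W.c_relation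
  have e1 : (↑W.Δ'⁻¹ : AlgebraicClosure ℚ) * W.Δ = 1 := by rw [← W.coe_Δ']; exact W.Δ'.inv_mul
  rw [WeierstrassCurve.j]
  linear_combination (W.c₄ ^ 3) * e1 - hc

/-- Valuations of small integers at the place over `3`: units. [folklore] -/
theorem valuation_intCast_eq_one_of_not_dvd {n : ℤ} (hn : ¬ (3 : ℤ) ∣ n) :
    (placeOver 3).valuation (n : AlgebraicClosure ℚ) = 1 :=
  valuation_placeOver_intCast_eq_one 3 (by exact_mod_cast hn)

/-- `v(x − y) = v(x)` when `v(y) < v(x)`. [folklore] -/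
theorem valuation_sub_eq_of_lt {x y : AlgebraicClosure ℚ}
    (h : (placeOver 3).valuation y < (placeOver 3).valuation x) :
    (placeOver 3).valuation (x - y) = (placeOver 3).valuation x := by
  rw [sub_eq_add_neg]
  exact Valuation.map_add_eq_of_lt_left _ (by rwa [Valuation.map_neg])

/-- `v(x − y) = v(y)` when `v(x) < v(y)`. [folklore] -/
theorem valuation_sub_eq_of_lt' {x y : AlgebraicClosure ℚ}
    (h : (placeOver 3).valuation x < (placeOver 3).valuation y) :
    (placeOver 3).valuation (x - y) = (placeOver 3).valuation y := by
  rw [sub_eq_add_neg, Valuation.map_add_eq_of_lt_right _ (by rwa [Valuation.map_neg]),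
    Valuation.map_neg]

/-- **§1. The shape exponent from `j − 1728`.**  In normal shape, if
`v(a₂)²·v(2a₂² − 9)² = v(3)^m · v(a₂² − 4)` — the valuation of `(j − 1728)·Δ = c₆²` — with
`1 ≤ m ≤ 5`, then `v(a₂) < 1`, `v(a₂² − 4) = 1` and **`v(a₂)⁶ = v(3)^m`**.  (The three regimes
`v(a₂) ≥ 1`, `v(3) < v(a₂) < 1`, `v(a₂) ≤ v(3)` give `v(j − 1728) ≥ 1`, `= v(a₂)⁶`, `≤ v(3)⁶`.)
[folklore] -/
theorem valuation_a₂_of_shape {m : ℕ} (hm1 : 1 ≤ m) (hm5 : m ≤ 5)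
    (hj : (placeOver 3).valuation W.a₂ ^ 2 *
        (placeOver 3).valuation (2 * W.a₂ ^ 2 - 9) ^ 2 =
      (placeOver 3).valuation (3 : AlgebraicClosure ℚ) ^ m *
        (placeOver 3).valuation (W.a₂ ^ 2 - 4)) :
    (placeOver 3).valuation W.a₂ < 1 ∧
      (placeOver 3).valuation (W.a₂ ^ 2 - 4) = 1 ∧
      (placeOver 3).valuation W.a₂ ^ 6 = (placeOver 3).valuation (3 : AlgebraicClosure ℚ) ^ m := by
  set v := (placeOver 3).valuation with hv
  set t := v (3 : AlgebraicClosure ℚ) with ht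
  have ht1 : t < 1 := valuation_three_lt_one
  have ht0 : t ≠ 0 := valuation_three_ne_zero
  have htm1 : t ^ m < 1 := pow_lt_one₀ zero_le ht1 (by omega)
  set α := v W.a₂ with hα
  have h2 : v (2 : AlgebraicClosure ℚ) = 1 := by
    simpa using valuation_intCast_eq_one_of_not_dvd (n := 2) (by decide)
  have h4 : v (4 : AlgebraicClosure ℚ) = 1 := by
    simpa using valuation_intCast_eq_one_of_not_dvd (n := 4) (by decide)
  have h9 : v (9 : AlgebraicClosure ℚ) = t ^ 2 := by
    rw [show (9 : AlgebraicClosure ℚ) = 3 ^ 2 by norm_num, map_pow]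
  have h2a : v (2 * W.a₂ ^ 2) = α ^ 2 := by rw [map_mul, h2, one_mul, map_pow]
  have ha2 : v (W.a₂ ^ 2) = α ^ 2 := map_pow _ _ _
  -- Step A: `α < 1`
  have hαlt : α < 1 := by
    by_contra hge
    rw [not_lt] at hge
    have hα2 : 1 ≤ α ^ 2 := one_le_pow₀ hge
    have h29 : v (2 * W.a₂ ^ 2 - 9) = α ^ 2 := by
      rw [valuation_sub_eq_of_lt (by rw [h9, h2a]; exact (pow_lt_one₀ zero_le ht1 two_ne_zero).trans_le hα2), h2a]
    rcases hge.lt_or_eq with hgt | heq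
    · -- `α > 1`: `v(a₂² − 4) = α²`, so `α⁴ = t^m`, absurd
      have hα2' : 1 < α ^ 2 := one_lt_pow₀ hgt two_ne_zero
      have h24 : v (W.a₂ ^ 2 - 4) = α ^ 2 := by
        rw [valuation_sub_eq_of_lt (by rw [h4, ha2]; exact hα2'), ha2]
      rw [h29, h24] at hj
      have hα0 : α ^ 2 ≠ 0 := ne_of_gt (lt_trans zero_lt_one hα2')
      rw [pow_two (α ^ 2), ← mul_assoc] at hj
      have h4m : α ^ 2 * α ^ 2 = t ^ m := mul_right_cancel₀ hα0 hj
      have : (1 : _) < t ^ m := by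
        rw [← h4m]
        calc (1 : _) < α ^ 2 := hα2'
          _ = α ^ 2 * 1 := (mul_one _).symm
          _ ≤ α ^ 2 * α ^ 2 := mul_le_mul' le_rfl hα2'.le
      exact absurd (this.trans htm1) (lt_irrefl _)
    · -- `α = 1`: `1 = t^m · v(a₂² − 4) ≤ t^m < 1`
      have h24 : v (W.a₂ ^ 2 - 4) ≤ 1 := by
        refine Valuation.map_sub_le _ ?_ (by rw [h4])
        rw [ha2, ← heq, one_pow]
      rw [h29, ← heq, one_pow, one_pow, one_mul] at hj
      have : t ^ m * v (W.a₂ ^ 2 - 4) < 1 :=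
        mul_lt_one_of_nonneg_of_lt_one_left zero_le htm1 h24
      rw [← hj] at this
      exact absurd this (lt_irrefl _)
  -- Step B: `v(a₂² − 4) = 1`
  have h24 : v (W.a₂ ^ 2 - 4) = 1 := by
    rw [valuation_sub_eq_of_lt' (by rw [h4, ha2]; exact pow_lt_one₀ zero_le hαlt two_ne_zero), h4]
  refine ⟨hαlt, h24, ?_⟩
  rw [h24, mul_one] at hj
  rcases lt_or_ge t α with htα | hαt
  · -- `t < α`: `v(2a₂² − 9) = α²`
    have h29 : v (2 * W.a₂ ^ 2 - 9) = α ^ 2 := by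
      rw [valuation_sub_eq_of_lt (by rw [h9, h2a]; exact pow_lt_pow_left₀ htα zero_le two_ne_zero),
        h2a]
    rw [h29] at hj
    rw [← hj, ← pow_mul, ← pow_add]
  · -- `α ≤ t`: `t^m ≤ t⁶`, absurd for `m ≤ 5`
    exfalso
    have h29 : v (2 * W.a₂ ^ 2 - 9) ≤ t ^ 2 := by
      refine Valuation.map_sub_le _ ?_ (by rw [h9])
      rw [h2a]; exact pow_le_pow_left₀ zero_le hαt 2
    have hle : t ^ m ≤ t ^ 6 := by
      calc t ^ m = α ^ 2 * v (2 * W.a₂ ^ 2 - 9) ^ 2 := hj.symm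
        _ ≤ t ^ 2 * (t ^ 2) ^ 2 :=
          mul_le_mul' (pow_le_pow_left₀ zero_le hαt 2) (pow_le_pow_left₀ zero_le h29 2)
        _ = t ^ 6 := by rw [← pow_mul, ← pow_add]
    exact absurd hle (not_le.mpr ((pow_lt_pow_iff_of_lt_one' ht0 ht1).mpr (by omega)))

/-- §1 in `j`-form: for an ELLIPTIC equation in normal shape, `v(j − 1728) = v(3)^m` with
`1 ≤ m ≤ 5` gives `v(a₂) < 1`, `v(a₂² − 4) = 1` (so `v(Δ) = 1`) and `v(a₂)⁶ = v(3)^m`. [folklore] -/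
theorem valuation_a₂_of_shape_of_j [W.IsElliptic] (h1 : W.a₁ = 0) (h3 : W.a₃ = 0) (h4 : W.a₄ = 1)
    (h6 : W.a₆ = 0) {m : ℕ} (hm1 : 1 ≤ m) (hm5 : m ≤ 5)
    (hj : (placeOver 3).valuation (W.j - 1728) = (placeOver 3).valuation (3 : AlgebraicClosure ℚ) ^ m) :
    (placeOver 3).valuation W.a₂ < 1 ∧
      (placeOver 3).valuation (W.a₂ ^ 2 - 4) = 1 ∧
      (placeOver 3).valuation W.Δ = 1 ∧
      (placeOver 3).valuation W.a₂ ^ 6 = (placeOver 3).valuation (3 : AlgebraicClosure ℚ) ^ m := by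
  set v := (placeOver 3).valuation with hv
  have h16 : v (16 : AlgebraicClosure ℚ) = 1 := by
    simpa using valuation_intCast_eq_one_of_not_dvd (n := 16) (by decide)
  have h32 : v (-32 : AlgebraicClosure ℚ) = 1 := by
    simpa using valuation_intCast_eq_one_of_not_dvd (n := -32) (by decide)
  have hrel := j_sub_mul_Δ_eq (W := W)
  rw [c₆_of_shape h1 h3 h4 h6, Δ_of_shape h1 h3 h4 h6] at hrel
  have hval := congrArg v hrel
  rw [map_mul, map_mul, hj, h16, one_mul, map_pow, map_mul, map_mul, h32, one_mul, mul_pow] at hval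
  obtain ⟨hα, h24, h6'⟩ := valuation_a₂_of_shape (W := W) hm1 hm5 hval.symm
  refine ⟨hα, h24, ?_, h6'⟩
  rw [Δ_of_shape h1 h3 h4 h6, map_mul, h16, one_mul, h24]

end Shape

end Summit.BirchSwinnertonDyer.Rank1Residual.GaloisImage

end
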